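import Summits.BirchSwinnertonDyer.BirchSwinnertonDyer.Theorems.ClassRecordThreeCornerAtThreeCoChainDefs
import Summits.BirchSwinnertonDyer.BirchSwinnertonDyer.Theorems.ClassRecordThreeCornerAtThreeBranchesDefs
import Summits.BirchSwinnertonDyer.Rank1Residual.X11b.Three.StepLHalves
import Summits.BirchSwinnertonDyer.Rank1Residual.X1.UnrSeriesFirstUnitCoeff
import Literature.NumberTheory.EllipticCurves.KellerYin2024.AnomalousLambdaInvariants
import HarnessLib

/-!
# Crux idea `biquadratic-reflex-eisenstein-descent-at-3` (item stmt-BirchSwinnertonDyer-19111 `CornerAtThree`,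
# STEP L conjunct `Three.CornerStepLAt`) — typed candidate Props + the PROVED kernel glue (planner sketch,
# cell `bsd-stepL`, seat `bsd-stepL-mult-idea` g2). Nothing asserted about any curve; no `sorry`.

THE LEVER (informal; the card `idea-biquadratic-reflex-eisenstein-descent-at-3.md`): on every (T4″)@3 corner
frame `(E, K, P, κ, γ, 𝔭)` let `F` be the Cartan field of `ρ̄_{E,3}` (3Ns: `F⁺` or `F⁻` with `3` split;
3Nn: the unique imaginary `F`, `3` ramified) and `L := K·F` (CM biquadratic, the REFLEX field of the frame). Then
`E[3]|_{G_K} ⊗ 𝔽₉ ≅ Ind_L^K ψ̄_L`, so over `L_∞ := L·K_∞^{ac}` the pair `(E,3)` is residually EISENSTEIN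
(`ψ̄_L ⊕ ψ̄_L^c`) and the residual BDP Selmer group of `E` over `K_∞` IS (Shapiro, `[L:K] = 2` prime to `3`)
a CHARACTER Selmer group over `L_∞` for the `K`-induced CM type `Σ_K` of `L`, which is `3`-ORDINARY because
`3` splits in `K` — for every corner curve and every Heegner field, independently of `F`.
The package: D1 algebraic residual `μ/λ` comparison over `L_∞` (CGLS 2022 §2 / Greenberg–Vatsal shape);
D2 analytic congruence at `3 ∥ N` between the BDP element of `f_E` and that of the weight-ONE theta series
`h = θ(ψ̃_F)` = the Katz–Hida–Tilouine measure of `(L, Σ_K)` on the `ψ̃_L`-twisted anticyclotomic line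
(Kriz 2016 / Kriz–Li 2019 shape); D3 = CM main conjecture + `μ = 0` for `(L, Σ_K)` on that line (the
beyond-print anchor at `p = 3`); D4 = the numerical criterion below (KERNEL: `cornerIMCEqAt_of_div_of_muLambda`,
`cornerStepLAt_of_reflexPackage`).

What is typed here, over tree declarations only:
* `ReflexMuLambdaAt W` — THE candidate Prop (output of D1+D2+D3): on every corner frame, every BDP frame
  `L ∈ R₀⟦T⟧` of the newform of `E` and every generator `𝓕` of `Ch_Λ(X_ac^∅)`: `μ(𝓕) = μ(L) = 0` and
  `λ(𝓕) = λ(L)` (first unit coefficients at the same index; tree `KellerYin2024.FirstUnitCoeffAt`) — the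
  (T4″)@3-corner twin of the tree's `X1.KellerYinHalves.GoodLatticeMuLambdaOnTree`.
* `CornerDivWithErrorAt W` — the Kolyvagin-system («⊇») divisibility with bounded `3`-power error, ideal level
  (lane B's object strengthened from `𝟙` to `Λ^{ur}[1/3]`; corner twin of `X1.KellerYinHalves.GoodLatticeDivOnTree`).
* `CornerBDPExistsAt W`, `CornerBDPValueAt W`, `CornerCharValuedAt W` — the corner frames' analytic inputs
  (`Three.BDPExistsAt₃` / `Three.BDPValueAt₃` / CTL₀ VERBATIM with `Surj W 3` replaced by `¬ Surj W 3`; the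
  first is item 20448's `p ∥ N` object read on the corner).
* `CornerIMCEqAt W` — the full anticyclotomic IMC as an equality of ideals of `R₀⟦T⟧` on corner frames.
KERNEL (no sorry): `cornerIMCEqAt_of_div_of_muLambda` (numerical criterion, via the tree's
`X1.KellerYinHalves.span_singleton_eq_of_C_pow_mul_mem`) and `cornerStepLAt_of_reflexPackage`
(⊢ `Three.CornerStepLAt W`, the STEP L conjunct of the crux for `W`, via `imcLowerWaldspurgerOnTreeAt_of_value_of_dvd`),
`cornerCharValuedAt_of_coStepLAt` (lane B's `CornerCoStepLAt` supplies CTL₀), `cornerAtThreeStepL_of_reflexPackage`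
(⊢ the registered stub constant `Theorems.CornerAtThreeStepL`).
-/

noncomputable section

open scoped Classical NumberField

open WeierstrassCurve NumberField IsDedekindDomain Field PowerSeries
  Literature.NumberTheory.EllipticCurves Literature.NumberTheory.EllipticCurves.ModularForms
  Literature.NumberTheory.EllipticCurves.Rank1Residual
  Literature.NumberTheory.GaloisRepresentations
  Literature.NumberTheory.EllipticCurves.KellerYin2024
  Summit.BirchSwinnertonDyer.Rank1Residual Summit.BirchSwinnertonDyer.Rank1Residual.X11b
  Summit.BirchSwinnertonDyer.Rank1Residual.X11b.AcSelmer
  Summit.BirchSwinnertonDyer.Rank1Residual.X11b.Halves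
  Summit.BirchSwinnertonDyer.Rank1Residual.X11b.Three

set_option linter.dupNamespace false
set_option autoImplicit false

namespace Summit.BirchSwinnertonDyer.BirchSwinnertonDyer.Cruxes.CornerAtThree.BiquadraticReflex

variable (W : WeierstrassCurve ℚ) [W.IsElliptic] [W.IsGloballyMinimal]

/-- **H1 on the corner** — `Three.BDPExistsAt₃ W` VERBATIM with `Surj W 3` replaced by `¬ Surj W 3`: a BDP frame
`(ι', Ω_K, Ω_p, L)` of the newform at `3 ∥ N` exists on every corner frame (item 20448's `p ∥ N` object; LZZ18
Thm. 1.5.1/1.5.3 shape; CONSTRUCTION missing in print at `p ∣ N` for Castella's normalisation). TYPED, not attempted. -/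
@[conjecture]
def CornerBDPExistsAt : Prop :=
  ∀ (N : ℕ) [NeZero N] (K : Type) [Field K] [NumberField K] (Dt : ModularParametrizationData W N)
    (H : HeegnerDatum N (NumberField.discr K)) (ι : K →+* ℂ) (P : (W.baseChange K).toAffine.Point),
    ClassX11b W 3 → ¬ Surj W 3 → W.conductorNorm ℤ = N → IsImaginaryQuadratic K →
    Odd (NumberField.discr K) → SatisfiesHeegnerHypothesis N K →
    (W.quadraticTwist (NumberField.discr K : ℚ)).entireLFunction 1 ≠ 0 →
    WeierstrassCurve.Affine.Point.map ι.toRatAlgHom P = heegnerPointComplex Dt H →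
    ¬ (3 : ℤ) ∣ Dt.c → ¬ IsOfFinAddOrder P →
    ∀ (κ : ZpExtension K 3), κ.IsAnticyclotomic →
      ∀ (γ : Field.absoluteGaloisGroup K) [Fact (κ.IsTopGenerator γ)]
        (𝔭 : HeightOneSpectrum (𝓞 K)), ((3 : ℕ) : 𝓞 K) ∈ 𝔭.asIdeal →
        𝔭.asIdeal.ramificationIdx (𝓞 ℚ) = 1 → 𝔭.asIdeal.inertiaDeg (𝓞 ℚ) = 1 →
        ∀ (f : CuspForm (CongruenceSubgroup.Gamma0 N) 2), IsNewformOf W f →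
          ∃ ι' : PadicAlgCl 3 ≃+* ℂ, InducesPrime ι' 𝔭 ∧
            ∃ (ΩK : ℂ) (Ωp : (unrIntegers 3)ˣ) (L : UnrSeries 3),
              ΩK ≠ 0 ∧ IsBDPLFunction ι' 𝔭 κ γ f ΩK ((Ωp : unrIntegers 3) : ℂ_[3]) L

/-- **H2 on the corner** — `Three.BDPValueAt₃ W` VERBATIM with `¬ Surj W 3`: the BDP/Waldspurger value at `𝟙`,
`L(0) = u·((1 − a₃·3⁻¹)·log_ω P)²`, `u ∈ R₀ˣ` (Castella 2018 Thm. 3.2 shape; formal in the frame). TYPED, not attempted. -/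
@[conjecture]
def CornerBDPValueAt : Prop :=
  ∀ (N : ℕ) [NeZero N] (K : Type) [Field K] [NumberField K] (Dt : ModularParametrizationData W N)
    (H : HeegnerDatum N (NumberField.discr K)) (ι : K →+* ℂ) (P : (W.baseChange K).toAffine.Point),
    ClassX11b W 3 → ¬ Surj W 3 → W.conductorNorm ℤ = N → IsImaginaryQuadratic K →
    Odd (NumberField.discr K) → SatisfiesHeegnerHypothesis N K →
    (W.quadraticTwist (NumberField.discr K : ℚ)).entireLFunction 1 ≠ 0 →
    WeierstrassCurve.Affine.Point.map ι.toRatAlgHom P = heegnerPointComplex Dt H →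
    ¬ (3 : ℤ) ∣ Dt.c → ¬ IsOfFinAddOrder P →
    ∀ (κ : ZpExtension K 3), κ.IsAnticyclotomic →
      ∀ (γ : Field.absoluteGaloisGroup K) [Fact (κ.IsTopGenerator γ)]
        (𝔭 : HeightOneSpectrum (𝓞 K)) (h𝔭 : ((3 : ℕ) : 𝓞 K) ∈ 𝔭.asIdeal)
        (he : 𝔭.asIdeal.ramificationIdx (𝓞 ℚ) = 1) (hf : 𝔭.asIdeal.inertiaDeg (𝓞 ℚ) = 1),
        ∀ (f : CuspForm (CongruenceSubgroup.Gamma0 N) 2), IsNewformOf W f →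
          ∀ (ι' : PadicAlgCl 3 ≃+* ℂ), InducesPrime ι' 𝔭 →
            ∀ (ΩK : ℂ) (Ωp : (unrIntegers 3)ˣ) (L : UnrSeries 3), ΩK ≠ 0 →
              IsBDPLFunction ι' 𝔭 κ γ f ΩK ((Ωp : unrIntegers 3) : ℂ_[3]) L →
                ∃ u : (unrIntegers 3)ˣ, L.HasValueAt 0 (((u : unrIntegers 3) : ℂ_[3]) *
                  (algebraMap ℚ_[3] ℂ_[3] (((1 : ℚ_[3]) - ((W.LFunction 3 : ℤ) : ℚ_[3]) * (3 : ℚ_[3])⁻¹) *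
                    logOmega W 3 (embAt K 3 𝔭 h𝔭 he hf) P)) ^ 2)

/-- **CTL₀ on the corner** — `Ch_Λ(X_ac^∅)` is torsion with a generator of NON-ZERO constant term of some
valuation `n` on every corner frame (`Three.CharTorsionAt₃` shape with `¬ Surj W 3`); supplied by lane B's
`Three.CornerCoStepLAt` (`cornerCharValuedAt_of_coStepLAt`) or by the control identity. TYPED, not attempted. -/
@[conjecture]
def CornerCharValuedAt : Prop :=
  ∀ (N : ℕ) [NeZero N] (K : Type) [Field K] [NumberField K] (Dt : ModularParametrizationData W N)
    (H : HeegnerDatum N (NumberField.discr K)) (ι : K →+* ℂ) (P : (W.baseChange K).toAffine.Point),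
    ClassX11b W 3 → ¬ Surj W 3 → W.conductorNorm ℤ = N → IsImaginaryQuadratic K →
    Odd (NumberField.discr K) → SatisfiesHeegnerHypothesis N K →
    (W.quadraticTwist (NumberField.discr K : ℚ)).entireLFunction 1 ≠ 0 →
    WeierstrassCurve.Affine.Point.map ι.toRatAlgHom P = heegnerPointComplex Dt H →
    ¬ (3 : ℤ) ∣ Dt.c → ¬ IsOfFinAddOrder P →
    ∀ (κ : ZpExtension K 3), κ.IsAnticyclotomic →
      ∀ (γ : Field.absoluteGaloisGroup K) [Fact (κ.IsTopGenerator γ)]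
        (𝔭 : HeightOneSpectrum (𝓞 K)), ((3 : ℕ) : 𝓞 K) ∈ 𝔭.asIdeal →
        𝔭.asIdeal.ramificationIdx (𝓞 ℚ) = 1 → 𝔭.asIdeal.inertiaDeg (𝓞 ℚ) = 1 →
        ∃ n : ℕ, XAc.HasCharValuationAt (W.baseChange K) 3 κ 𝔭 ∅ γ n

/-- **D-DIV — the Kolyvagin-system («⊇») divisibility with bounded `3`-power error, IDEAL level, on the corner
frames**: `X_ac^∅` is `Λ`-torsion and `3^k · L ∈ Ch_Λ(X_ac^∅)·R₀⟦T⟧` for some `k` (Howard 2004 Thm. B ∕ CGLS 2022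
Thm. 4.1.1 + Prop. 4.2.1 shape WITH ERROR, read WITHOUT (sur): lane B's `CornerCoStepLAt` is this at `𝟙` with
`k = 0`). OPEN on the corner (Howard/BCK21/BCS24 need (sur) or exclude `p = 3`); corner twin of
`X1.KellerYinHalves.GoodLatticeDivOnTree`. TYPED, not attempted; nothing asserted. -/
@[conjecture]
def CornerDivWithErrorAt : Prop :=
  ∀ (N : ℕ) [NeZero N] (K : Type) [Field K] [NumberField K] (Dt : ModularParametrizationData W N)
    (H : HeegnerDatum N (NumberField.discr K)) (ι : K →+* ℂ) (P : (W.baseChange K).toAffine.Point),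
    ClassX11b W 3 → ¬ Surj W 3 → W.conductorNorm ℤ = N → IsImaginaryQuadratic K →
    Odd (NumberField.discr K) → SatisfiesHeegnerHypothesis N K →
    (W.quadraticTwist (NumberField.discr K : ℚ)).entireLFunction 1 ≠ 0 →
    WeierstrassCurve.Affine.Point.map ι.toRatAlgHom P = heegnerPointComplex Dt H →
    ¬ (3 : ℤ) ∣ Dt.c → ¬ IsOfFinAddOrder P →
    ∀ (κ : ZpExtension K 3), κ.IsAnticyclotomic →
      ∀ (γ : Field.absoluteGaloisGroup K) [Fact (κ.IsTopGenerator γ)]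
        (𝔭 : HeightOneSpectrum (𝓞 K)), ((3 : ℕ) : 𝓞 K) ∈ 𝔭.asIdeal →
        𝔭.asIdeal.ramificationIdx (𝓞 ℚ) = 1 → 𝔭.asIdeal.inertiaDeg (𝓞 ℚ) = 1 →
        ∀ (f : CuspForm (CongruenceSubgroup.Gamma0 N) 2), IsNewformOf W f →
          ∀ (ι' : PadicAlgCl 3 ≃+* ℂ), InducesPrime ι' 𝔭 →
            ∀ (ΩK : ℂ) (Ωp : (unrIntegers 3)ˣ) (L : UnrSeries 3), ΩK ≠ 0 →
              IsBDPLFunction ι' 𝔭 κ γ f ΩK ((Ωp : unrIntegers 3) : ℂ_[3]) L →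
                Module.IsTorsion (IwasawaAlgebra 3) (XAc (W.baseChange K) 3 κ 𝔭 ∅ γ) ∧
                  ∃ k : ℕ, C ((3 : unrIntegers 3) ^ k) * L ∈
                    (XAc.charIdeal (W.baseChange K) 3 κ 𝔭 ∅ γ).map (PowerSeries.map (toUnr 3))

/-- **D-μλ — THE CANDIDATE PROP of the card (output of the reflex package D1+D2+D3): `μ = 0` and `λ`-EQUALITY on the
(T4″)@3 corner.** On every corner frame, every BDP frame `L` of the newform and every generator `𝓕` of `Ch_Λ(X_ac^∅)`,
the first unit coefficient of `𝓕` (read in `R₀`) and that of `L` sit at the SAME index: `μ(X_ac) = μ(𝓕) = 0 = μ(L)`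
and `λ(X_ac) = λ(L)`. MECHANISM: both sides are computed RESIDUALLY over the reflex tower `L_∞ = K·F·K_∞^{ac}` where
`(E,3)` is Eisenstein — algebraic side = `λ/μ` of the `ψ̃_L`-character Selmer group for the ordinary CM type `Σ_K`
plus local terms (CGLS 2022 Thm. 2.2.4 `mulambda` shape); analytic side = `λ/μ` of the Katz–Hida–Tilouine measure of
`(L, Σ_K)` on the `ψ̃_L`-line plus the same local terms (weight-one theta congruence, Kriz shape); the two CM-side
counts agree by the CM main conjecture + `μ = 0` for `(L, Σ_K)` (BEYOND PRINT at `p = 3`: Hsieh 2014 Thm. 2 (1)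
excludes `p = 3`; Hida 2010 / Hsieh 2011 `μ = 0` need `3 ∤ D_{L⁺}`, false on 3Nn). OPEN; NEVER cite as a theorem. -/
@[conjecture]
def ReflexMuLambdaAt : Prop :=
  ∀ (N : ℕ) [NeZero N] (K : Type) [Field K] [NumberField K] (Dt : ModularParametrizationData W N)
    (H : HeegnerDatum N (NumberField.discr K)) (ι : K →+* ℂ) (P : (W.baseChange K).toAffine.Point),
    ClassX11b W 3 → ¬ Surj W 3 → W.conductorNorm ℤ = N → IsImaginaryQuadratic K →
    Odd (NumberField.discr K) → SatisfiesHeegnerHypothesis N K →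
    (W.quadraticTwist (NumberField.discr K : ℚ)).entireLFunction 1 ≠ 0 →
    WeierstrassCurve.Affine.Point.map ι.toRatAlgHom P = heegnerPointComplex Dt H →
    ¬ (3 : ℤ) ∣ Dt.c → ¬ IsOfFinAddOrder P →
    ∀ (κ : ZpExtension K 3), κ.IsAnticyclotomic →
      ∀ (γ : Field.absoluteGaloisGroup K) [Fact (κ.IsTopGenerator γ)]
        (𝔭 : HeightOneSpectrum (𝓞 K)), ((3 : ℕ) : 𝓞 K) ∈ 𝔭.asIdeal →
        𝔭.asIdeal.ramificationIdx (𝓞 ℚ) = 1 → 𝔭.asIdeal.inertiaDeg (𝓞 ℚ) = 1 →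
        ∀ (f : CuspForm (CongruenceSubgroup.Gamma0 N) 2), IsNewformOf W f →
          ∀ (ι' : PadicAlgCl 3 ≃+* ℂ), InducesPrime ι' 𝔭 →
            ∀ (ΩK : ℂ) (Ωp : (unrIntegers 3)ˣ) (L : UnrSeries 3), ΩK ≠ 0 →
              IsBDPLFunction ι' 𝔭 κ γ f ΩK ((Ωp : unrIntegers 3) : ℂ_[3]) L →
                ∀ F : IwasawaAlgebra 3, XAc.charIdeal (W.baseChange K) 3 κ 𝔭 ∅ γ = Ideal.span {F} →
                  ∃ n : ℕ, FirstUnitCoeffAt (PowerSeries.map (toUnr 3) F) n ∧ FirstUnitCoeffAt L n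

/-- **D-EQ — the anticyclotomic BDP main conjecture as an EQUALITY of ideals of `R₀⟦T⟧` on the corner frames**:
`X_ac^∅` torsion and `Ch_Λ(X_ac^∅)·R₀⟦T⟧ = (L)`. OPEN; nothing asserted. -/
@[conjecture]
def CornerIMCEqAt : Prop :=
  ∀ (N : ℕ) [NeZero N] (K : Type) [Field K] [NumberField K] (Dt : ModularParametrizationData W N)
    (H : HeegnerDatum N (NumberField.discr K)) (ι : K →+* ℂ) (P : (W.baseChange K).toAffine.Point),
    ClassX11b W 3 → ¬ Surj W 3 → W.conductorNorm ℤ = N → IsImaginaryQuadratic K →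
    Odd (NumberField.discr K) → SatisfiesHeegnerHypothesis N K →
    (W.quadraticTwist (NumberField.discr K : ℚ)).entireLFunction 1 ≠ 0 →
    WeierstrassCurve.Affine.Point.map ι.toRatAlgHom P = heegnerPointComplex Dt H →
    ¬ (3 : ℤ) ∣ Dt.c → ¬ IsOfFinAddOrder P →
    ∀ (κ : ZpExtension K 3), κ.IsAnticyclotomic →
      ∀ (γ : Field.absoluteGaloisGroup K) [Fact (κ.IsTopGenerator γ)]
        (𝔭 : HeightOneSpectrum (𝓞 K)), ((3 : ℕ) : 𝓞 K) ∈ 𝔭.asIdeal →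
        𝔭.asIdeal.ramificationIdx (𝓞 ℚ) = 1 → 𝔭.asIdeal.inertiaDeg (𝓞 ℚ) = 1 →
        ∀ (f : CuspForm (CongruenceSubgroup.Gamma0 N) 2), IsNewformOf W f →
          ∀ (ι' : PadicAlgCl 3 ≃+* ℂ), InducesPrime ι' 𝔭 →
            ∀ (ΩK : ℂ) (Ωp : (unrIntegers 3)ˣ) (L : UnrSeries 3), ΩK ≠ 0 →
              IsBDPLFunction ι' 𝔭 κ γ f ΩK ((Ωp : unrIntegers 3) : ℂ_[3]) L →
                Module.IsTorsion (IwasawaAlgebra 3) (XAc (W.baseChange K) 3 κ 𝔭 ∅ γ) ∧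
                  (XAc.charIdeal (W.baseChange K) 3 κ 𝔭 ∅ γ).map (PowerSeries.map (toUnr 3)) =
                    Ideal.span {L}

variable {W}

omit [W.IsElliptic] [W.IsGloballyMinimal] in
/-- **D4, KERNEL — the numerical criterion on the corner**: ONE divisibility with bounded `3`-power error (D-DIV) +
`μ = 0` and `λ`-equality (D-μλ) ⟹ the EQUALITY of ideals (D-EQ). Pure `R₀⟦T⟧`-algebra
(`X1.KellerYinHalves.span_singleton_eq_of_C_pow_mul_mem`; `charIdeal_isPrincipal_holds`). [folklore] -/
theorem cornerIMCEqAt_of_div_of_muLambda (hdiv : CornerDivWithErrorAt W) (hml : ReflexMuLambdaAt W) :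
    CornerIMCEqAt W := by
  intro N _ K _ _ Dt H ι P hX hns hN hK hodd hheeg hL1 hP hc hP0 κ hκ γ _ 𝔭 h𝔭 he hf f hfW ι' hι' ΩK Ωp
    L hΩK hL
  obtain ⟨htors, k, hk⟩ := hdiv N K Dt H ι P hX hns hN hK hodd hheeg hL1 hP hc hP0 κ hκ γ 𝔭 h𝔭 he hf f
    hfW ι' hι' ΩK Ωp L hΩK hL
  obtain ⟨F, hF⟩ := (charIdeal_isPrincipal_holds 3 (XAc (W.baseChange K) 3 κ 𝔭 ∅ γ)).principal
  have hchar : XAc.charIdeal (W.baseChange K) 3 κ 𝔭 ∅ γ = Ideal.span {F} := hF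
  obtain ⟨n, hFn, hLn⟩ := hml N K Dt H ι P hX hns hN hK hodd hheeg hL1 hP hc hP0 κ hκ γ 𝔭 h𝔭 he hf f
    hfW ι' hι' ΩK Ωp L hΩK hL F hchar
  rw [hchar, Ideal.map_span, Set.image_singleton] at hk ⊢
  exact ⟨htors, X1.KellerYinHalves.span_singleton_eq_of_C_pow_mul_mem hk
    ((firstUnitCoeffAt_iff _ _).mp hFn) ((firstUnitCoeffAt_iff _ _).mp hLn)⟩

/-- Lane B's «⊇» half at `𝟙` supplies CTL₀ on the corner. Bookkeeping. [folklore] -/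
theorem cornerCharValuedAt_of_coStepLAt (h : CornerCoStepLAt W) : CornerCharValuedAt W := by
  intro N _ K _ _ Dt H ι P hX hns hN hK hodd hheeg hL1 hP hc hP0 κ hκ γ _ 𝔭 h𝔭 he hf
  obtain ⟨n, hn, -⟩ := h N K Dt H ι P hX hns hN hK hodd hheeg hL1 hP hc hP0 κ hκ γ 𝔭 h𝔭 he hf
  exact ⟨n, hn⟩

/-- **KERNEL — the reflex package decides the STEP L conjunct of the crux for `W`**: newform supply + CTL₀ + H1 +
H2 on the corner + D-DIV + D-μλ ⟹ `Three.CornerStepLAt W` (through D-EQ and the tree's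
`imcLowerWaldspurgerOnTreeAt_of_value_of_dvd`). CONDITIONAL on the displayed inputs; nothing booked. [folklore] -/
theorem cornerStepLAt_of_reflexPackage (hnf : exists_isNewformOf) (hval : CornerCharValuedAt W)
    (h1 : CornerBDPExistsAt W) (h2 : CornerBDPValueAt W) (hdiv : CornerDivWithErrorAt W)
    (hml : ReflexMuLambdaAt W) : CornerStepLAt W := by
  have heq := cornerIMCEqAt_of_div_of_muLambda hdiv hml
  intro N _ K _ _ Dt H ι P hX hns hN hK hodd hheeg hL1 hP hc hP0 κ hκ γ _ 𝔭 h𝔭 he hf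
  subst hN
  obtain ⟨f, hfW⟩ := hnf W
  obtain ⟨ι', hι', ΩK, Ωp, L, hΩK, hL⟩ :=
    h1 _ K Dt H ι P hX hns rfl hK hodd hheeg hL1 hP hc hP0 κ hκ γ 𝔭 h𝔭 he hf f hfW
  obtain ⟨u, hu⟩ :=
    h2 _ K Dt H ι P hX hns rfl hK hodd hheeg hL1 hP hc hP0 κ hκ γ 𝔭 h𝔭 he hf f hfW ι' hι' ΩK Ωp L hΩK hL
  obtain ⟨-, hEq⟩ :=
    heq _ K Dt H ι P hX hns rfl hK hodd hheeg hL1 hP hc hP0 κ hκ γ 𝔭 h𝔭 he hf f hfW ι' hι' ΩK Ωp L hΩK hL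
  obtain ⟨n, hn⟩ := hval _ K Dt H ι P hX hns rfl hK hodd hheeg hL1 hP hc hP0 κ hκ γ 𝔭 h𝔭 he hf
  exact imcLowerWaldspurgerOnTreeAt_of_value_of_dvd hn hEq.le u (W.LFunction 3) hu

/-- **KERNEL — the same package ALSO gives lane B's co-half at `𝟙` back (the equality is symmetric)**: D-EQ at a
frame with CTL₀ and H2 ⟹ `IMCWaldspurgerOnTreeAt` ⟹ both halves. Recorded as the implication
`CornerStepLAt W` of the package; the co-direction is `Three.CornerCoStepLAt W` whenever the tree's
`imcUpperWaldspurgerOnTreeAt_of_value_of_dvd'`-type reading is available — NOT attempted here (honest scope). -/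
theorem cornerAtThreeStepL_of_reflexPackage (hnf : exists_isNewformOf)
    (hval : ∀ (W : WeierstrassCurve ℚ) [W.IsElliptic] [W.IsGloballyMinimal], CornerCharValuedAt W)
    (h1 : ∀ (W : WeierstrassCurve ℚ) [W.IsElliptic] [W.IsGloballyMinimal], CornerBDPExistsAt W)
    (h2 : ∀ (W : WeierstrassCurve ℚ) [W.IsElliptic] [W.IsGloballyMinimal], CornerBDPValueAt W)
    (hdiv : ∀ (W : WeierstrassCurve ℚ) [W.IsElliptic] [W.IsGloballyMinimal], CornerDivWithErrorAt W)
    (hml : ∀ (W : WeierstrassCurve ℚ) [W.IsElliptic] [W.IsGloballyMinimal], ReflexMuLambdaAt W) :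
    Summit.BirchSwinnertonDyer.BirchSwinnertonDyer.Theorems.CornerAtThreeStepL := by
  intro W _ _
  exact cornerStepLAt_of_reflexPackage hnf (hval W) (h1 W) (h2 W) (hdiv W) (hml W)

end Summit.BirchSwinnertonDyer.BirchSwinnertonDyer.Cruxes.CornerAtThree.BiquadraticReflex

end
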